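import Summits.QuantumFields.YangMills.Theorems.RationalShortRootRigidityDihedralChevalley
import HarnessLib

/-!
# `RationalShortRootRigidity` — Step 2 assembly helper (§E of the `stub_planar` plan): top forms inherit linear symmetries

Helper lemmas INSIDE the paper proof of crux `stmt-QuantumFields-23124` (`F4SubCurvatureDoor.RationalShortRootRigidity`,
LINE g15-A of planner ym-idea-3; owner's assembly plan HOME l15/STUB-PLAN-Planar.md §E: «homogeneous components inherit linear
symmetries», needed to feed the evenness / `120°`-invariance hypotheses of `mobiusTopForm` (p665007) with the top form of the planar
restriction):

* `homogeneousComponent_bind₁_linear` — for a substitution `f` by LINEAR forms (each `f i` homogeneous of degree `1`),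
  `homogeneousComponent n (bind₁ f φ) = bind₁ f (homogeneousComponent n φ)`;
* `eval_homogeneousComponent_invariant` — if `φ(G v) = φ(v)` for all `v`, where the linear map `G` is given algebraically by such an `f`,
  then every homogeneous component of `φ` is `G`-invariant; specialised to the plane reflection `x ↦ −x`
  (`homogeneousComponent_even`) and the rotation by `120°` (`homogeneousComponent_rot`) in the form used by `mobiusTopForm`.

Mathlib + the tree helpers of `RationalShortRootRigidityDihedralChevalley.lean` (`eval_bind₁_eq`, `pt_ext`, `if_one_eq`); THEOREMS ONLY;
no named facts; no `sorry`; default heartbeats.  Nothing about the crux 23124, the route's rung or the Yang–Mills mass gap is proved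
here.  Free-hands seat `ym-line-frs-p2` g10, `--supports stmt-QuantumFields-23124`.
-/

set_option autoImplicit false

namespace Summit.QuantumFields.YangMills.Theorems.RationalShortRootRigidity

open scoped BigOperators

/-- Homogeneous components commute with substitutions by linear forms. [folklore] -/
theorem homogeneousComponent_bind₁_linear {σ : Type*} (f : σ → MvPolynomial σ ℝ)
    (hf : ∀ i, (f i).IsHomogeneous 1) (φ : MvPolynomial σ ℝ) (n : ℕ) :
    MvPolynomial.homogeneousComponent n (MvPolynomial.bind₁ f φ) =
      MvPolynomial.bind₁ f (MvPolynomial.homogeneousComponent n φ) := by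
  classical
  have hpiece : ∀ m, MvPolynomial.homogeneousComponent n (MvPolynomial.bind₁ f (MvPolynomial.homogeneousComponent m φ)) =
      if n = m then MvPolynomial.bind₁ f (MvPolynomial.homogeneousComponent m φ) else 0 := by
    intro m
    have hhom : (MvPolynomial.bind₁ f (MvPolynomial.homogeneousComponent m φ)).IsHomogeneous m := by
      have := (MvPolynomial.homogeneousComponent_isHomogeneous m φ).aeval f hf
      rwa [one_mul] at this
    exact MvPolynomial.homogeneousComponent_of_mem hhom
  conv_lhs => rw [← MvPolynomial.sum_homogeneousComponent φ, map_sum, map_sum]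
  simp_rw [hpiece]
  rw [Finset.sum_ite_eq]
  split_ifs with h
  · rfl
  · rw [MvPolynomial.homogeneousComponent_eq_zero, map_zero]
    rw [Finset.mem_range, not_lt] at h
    omega

/-- Homogeneous components of a polynomial invariant under a linear map are invariant. [folklore] -/
theorem eval_homogeneousComponent_invariant (φ : MvPolynomial (Fin 2) ℝ) (f : Fin 2 → MvPolynomial (Fin 2) ℝ)
    (hf : ∀ i, (f i).IsHomogeneous 1) (G : (Fin 2 → ℝ) → (Fin 2 → ℝ))
    (hfG : ∀ v : Fin 2 → ℝ, (fun i => MvPolynomial.eval v (f i)) = G v)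
    (hinv : ∀ v : Fin 2 → ℝ, MvPolynomial.eval (G v) φ = MvPolynomial.eval v φ) (n : ℕ) :
    ∀ v : Fin 2 → ℝ, MvPolynomial.eval (G v) (MvPolynomial.homogeneousComponent n φ) =
      MvPolynomial.eval v (MvPolynomial.homogeneousComponent n φ) := by
  have hbind : MvPolynomial.bind₁ f φ = φ := by
    apply MvPolynomial.funext
    intro v
    rw [eval_bind₁_eq, hfG, hinv]
  intro v
  rw [← hfG, ← eval_bind₁_eq, ← homogeneousComponent_bind₁_linear f hf, hbind]

/-- The top form of an even-in-`x` plane polynomial is even in `x`. [folklore] -/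
theorem homogeneousComponent_even (φ : MvPolynomial (Fin 2) ℝ)
    (h : ∀ v : Fin 2 → ℝ, MvPolynomial.eval (fun i => if i = 0 then -v 0 else v 1) φ = MvPolynomial.eval v φ) (n : ℕ) :
    ∀ v : Fin 2 → ℝ, MvPolynomial.eval (fun i => if i = 0 then -v 0 else v 1) (MvPolynomial.homogeneousComponent n φ) =
      MvPolynomial.eval v (MvPolynomial.homogeneousComponent n φ) := by
  refine eval_homogeneousComponent_invariant φ
    (fun i : Fin 2 => if i = 0 then -MvPolynomial.X 0 else MvPolynomial.X 1) (fun i => ?_)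
    (fun v i => if i = 0 then -v 0 else v 1) (fun v => ?_) h n
  · by_cases hi : i = 0
    · rw [if_pos hi]; exact (MvPolynomial.isHomogeneous_X ℝ 0).neg
    · rw [if_neg hi]; exact MvPolynomial.isHomogeneous_X ℝ 1
  · exact pt_ext (by simp only [if_true, map_neg, MvPolynomial.eval_X]) (by simp only [if_one_eq, MvPolynomial.eval_X])

/-- The top form of a `120°`-invariant plane polynomial is `120°`-invariant. [folklore] -/
theorem homogeneousComponent_rot (φ : MvPolynomial (Fin 2) ℝ)
    (h : ∀ v : Fin 2 → ℝ, MvPolynomial.eval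
      (fun i => if i = 0 then -(1/2 : ℝ) * v 0 - (Real.sqrt 3 / 2) * v 1
        else (Real.sqrt 3 / 2) * v 0 - (1/2 : ℝ) * v 1) φ = MvPolynomial.eval v φ) (n : ℕ) :
    ∀ v : Fin 2 → ℝ, MvPolynomial.eval
      (fun i => if i = 0 then -(1/2 : ℝ) * v 0 - (Real.sqrt 3 / 2) * v 1
        else (Real.sqrt 3 / 2) * v 0 - (1/2 : ℝ) * v 1) (MvPolynomial.homogeneousComponent n φ) =
      MvPolynomial.eval v (MvPolynomial.homogeneousComponent n φ) := by
  refine eval_homogeneousComponent_invariant φ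
    (fun i : Fin 2 => if i = 0 then
        MvPolynomial.C (-(1/2 : ℝ)) * MvPolynomial.X 0 - MvPolynomial.C (Real.sqrt 3 / 2) * MvPolynomial.X 1
      else MvPolynomial.C (Real.sqrt 3 / 2) * MvPolynomial.X 0 - MvPolynomial.C (1/2 : ℝ) * MvPolynomial.X 1) (fun i => ?_)
    (fun v i => if i = 0 then -(1/2 : ℝ) * v 0 - (Real.sqrt 3 / 2) * v 1
      else (Real.sqrt 3 / 2) * v 0 - (1/2 : ℝ) * v 1) (fun v => ?_) h n
  · by_cases hi : i = 0
    · rw [if_pos hi]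
      exact ((MvPolynomial.isHomogeneous_X ℝ 0).C_mul _).sub ((MvPolynomial.isHomogeneous_X ℝ 1).C_mul _)
    · rw [if_neg hi]
      exact ((MvPolynomial.isHomogeneous_X ℝ 0).C_mul _).sub ((MvPolynomial.isHomogeneous_X ℝ 1).C_mul _)
  · exact pt_ext (by simp only [if_true, map_sub, map_mul, MvPolynomial.eval_C, MvPolynomial.eval_X])
      (by simp only [if_one_eq, map_sub, map_mul, MvPolynomial.eval_C, MvPolynomial.eval_X])

end Summit.QuantumFields.YangMills.Theorems.RationalShortRootRigidity
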